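import Literature.AnabelianGeometry.EtaleTheta.Discharge.Sec2CompletionQuotients
import Literature.AnabelianGeometry.SemiGraphs.TemperedGroups

/-!
# [EtTh] Lemma 2.17 (ii) "Discrete Normalizers" for tempered groups — the inverse-limit argument

Mochizuki, *The Étale Theta Function and its Frobenioid-theoretic Manifestations* [EtTh],
Publ. RIMS 45 (2009), §2, Lemma 2.17 (ii), PRIMS text pp.58–59 (printed pp.284–285; locators
`p.N` = PDF pages of the PRIMS text; bib key `MochizukiEtTh2009`):

> "(ii) Let `Π` be the tempered fundamental group of a hyperbolic orbicurve over a finite extension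
> `K` of `ℚ_p`, `H ⊆ Π` an open subgroup. Write `Π̂` for the profinite completion of `Π`. Then
> `N_{Π̂}(H) = N_Π(H)`."  Proof (p.59): "Assertion (ii) now follows immediately from assertion (i) by
> applying assertion (i) to quotients of `Π` by characteristic open subgroups of `Π`, which contain
> finite rank free normal subgroups of finite index."

PROOF-ONLY companion (no definitions, no named facts introduced).  The "immediately" is an
inverse-limit argument, carried out here for an ARBITRARY tempered group `Π` (L3's
`SemiGraphs.IsTempered`, of which only completeness is used) with a profinite completion
`ι : Π → Π̂` (L3's frozen `SemiGraphs.IsProfiniteCompletion`, the field `isProfiniteCompletion_toHat`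
being added to `ThetaCovers.TemperedCoverData` by abc-iut-L2-t2 per the L2-lead ruling
2026-08-25T19:56Z):

* (in `Sec2CompletionQuotients.lean`) `exists_hom_completion_quotient`: for an open normal `N ⊴ Π`,
  the homomorphism `ψ_N : Π̂ → (Π/N)^` to Mathlib's profinite completion of the discrete quotient,
  characterised level-wise ("applying (i) to quotients of `Π` by open subgroups");
* `normalizer_map_eq_of_isTempered`: assertion (ii) in the shape of the typed statement
  `TemperedCoverData.Lem217_ii` (`normalizer (H.map ι) = (normalizer H).map ι`), from
  - assertion (i) as a HYPOTHESIS `h217i` in its typed shape `TemperedCoverData.Lem217_i`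
    (discharged modulo its three printed inputs in `Discharge/Sec2DiscreteNormalizers.lean`), and
  - the anabelian input `htower`: cofinally many open normal `N ⊴ Π` inside `H` such that `Π/N`
    "contain[s a] finite rank free normal subgroup of finite index" meeting `H/N` non-abelianly
    (for the tempered fundamental group of a hyperbolic orbicurve this is [André]'s structure of
    `Π^tp` — abc-iut FACT rows 13–14 — and is to be supplied as a NAMED FACT by the interface owner;
    it is NOT asserted here).

Honest framing: classical topological group theory; nothing here concerns [IUTchIII] Cor. 3.12;
typed ≠ discharged — Lemma 2.17 (ii) is discharged here MODULO `h217i` and `htower`.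
-/

namespace Literature.AnabelianGeometry.EtaleTheta.DiscreteNormalizers

open CategoryTheory ProfiniteGrp ProfiniteGrp.ProfiniteCompletion Topology
open Literature.AnabelianGeometry.SemiGraphs

universe u v

variable {P : Type u} [Group P] [TopologicalSpace P]
variable {Ph : Type v} [Group Ph] [TopologicalSpace Ph] [IsTopologicalGroup Ph]

/-- **[EtTh] Lemma 2.17 (ii) (Discrete Normalizers), abstract form over a tempered group with a
profinite completion.**  "Let `Π` be the tempered fundamental group of a hyperbolic orbicurve over a
finite extension `K` of `ℚ_p`, `H ⊆ Π` an open subgroup. Write `Π̂` for the profinite completion of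
`Π`. Then `N_{Π̂}(H) = N_Π(H)`."  Printed proof (p.59 = PRIMS p.285): "Assertion (ii) now follows
immediately from assertion (i) by applying assertion (i) to quotients of `Π` by characteristic open
subgroups of `Π`, which contain finite rank free normal subgroups of finite index."  Here: `Π` is any
tempered group (L3's `IsTempered`: only completeness is used), `ι : Π → Π̂` any profinite completion
(L3's `IsProfiniteCompletion`), assertion (i) enters as the HYPOTHESIS `h217i` (its typed shape
`TemperedCoverData.Lem217_i`, discharged modulo its printed inputs in `Sec2DiscreteNormalizers.lean`),
and the anabelian input is the hypothesis `htower`: cofinally many open normal `N ⊴ Π` inside `H`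
with `Π/N` containing a free normal subgroup of finite index and finite rank meeting `H/N`
non-abelianly.  The inverse-limit argument (level-wise normalizers via `exists_hom_completion_quotient`,
coherence by residual finiteness of the virtually free quotients, completeness of `Π`, and
`Π̂ = lim Π̂/V`) is carried out in full; injectivity of `ι` is not needed.
[cite: MochizukiEtTh2009, Lem 2.17(ii) pp.58–59] -/
theorem normalizer_map_eq_of_isTempered [IsTopologicalGroup P]
    (h217i : ∀ (F : Type u) [Group F] (G H : Subgroup F) [IsFreeGroup G], G.Normal → G.FiniteIndex →
      Finite (IsFreeGroup.Generators G) → (∃ a ∈ H ⊓ G, ∃ b ∈ H ⊓ G, a * b ≠ b * a) →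
      let η : F →* ProfiniteGrp.ProfiniteCompletion.completion (GrpCat.of F) :=
        (ProfiniteGrp.ProfiniteCompletion.eta (GrpCat.of F)).hom
      Subgroup.normalizer ((H.map η : Subgroup _) : Set _) =
        (Subgroup.normalizer (H : Set F)).map η)
    (hP : IsTempered P) (ι : P →ₜ* Ph) (hι : IsProfiniteCompletion ι) (H : Subgroup P)
    (htower : ∀ U ∈ 𝓝 (1 : P), ∃ N : OpenNormalSubgroup P, (N : Set P) ⊆ U ∧ N.toSubgroup ≤ H ∧
      ∃ (G : Subgroup (P ⧸ N.toSubgroup)) (_ : IsFreeGroup G), G.Normal ∧ G.FiniteIndex ∧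
        Finite (IsFreeGroup.Generators G) ∧
        ∃ a ∈ H.map (QuotientGroup.mk' N.toSubgroup) ⊓ G,
          ∃ b ∈ H.map (QuotientGroup.mk' N.toSubgroup) ⊓ G, a * b ≠ b * a) :
    Subgroup.normalizer ((H.map ι.toMonoidHom : Subgroup Ph) : Set Ph) =
      (Subgroup.normalizer (H : Set P)).map ι.toMonoidHom := by
  classical
  haveI : CompactSpace Ph := hι.compactSpace
  haveI : T2Space Ph := hι.t2Space
  haveI : TotallyDisconnectedSpace Ph := hι.totallyDisconnectedSpace
  apply le_antisymm
  swap
  · exact Subgroup.le_normalizer_map _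
  intro a ha
  -- "goodness" of a level `N`
  let Good : OpenNormalSubgroup P → Prop := fun N => N.toSubgroup ≤ H ∧
      ∃ (G : Subgroup (P ⧸ N.toSubgroup)) (_ : IsFreeGroup G), G.Normal ∧ G.FiniteIndex ∧
        Finite (IsFreeGroup.Generators G) ∧
        ∃ a ∈ H.map (QuotientGroup.mk' N.toSubgroup) ⊓ G,
          ∃ b ∈ H.map (QuotientGroup.mk' N.toSubgroup) ⊓ G, a * b ≠ b * a
  have hgood : ∀ U ∈ 𝓝 (1 : P), ∃ N : OpenNormalSubgroup P, (N : Set P) ⊆ U ∧ Good N := by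
    intro U hU
    obtain ⟨N, hNU, hNH, hrest⟩ := htower U hU
    exact ⟨N, hNU, hNH, hrest⟩
  -- residual finiteness of the good quotients
  have hrf : ∀ N, Good N → Group.ResiduallyFinite (P ⧸ N.toSubgroup) := by
    rintro N ⟨-, G, hG, hGn, hGfi, -, -⟩
    haveI := hG
    haveI := hGfi
    haveI := residuallyFinite_of_isFreeGroup G
    exact residuallyFinite_of_finiteIndex G
  -- STEP 1: at a good level `N`, Lemma 2.17 (i) produces `n_N ∈ N_Π(H)` with `a ∈ ι(n_N) · V`
  -- for every open normal `V ⊴ P̂` seen at level `N`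
  have key : ∀ N, Good N → ∃ n ∈ Subgroup.normalizer (H : Set P),
      ∀ (M : FiniteIndexNormalSubgroup (P ⧸ N.toSubgroup)) (V : OpenNormalSubgroup Ph),
        M.toSubgroup.comap (QuotientGroup.mk' N.toSubgroup) = V.toSubgroup.comap ι.toMonoidHom →
        a⁻¹ * ι n ∈ V := by
    rintro N ⟨hNH, G, hG, hGn, hGfi, hGfin, hnc⟩
    haveI := hG
    obtain ⟨ψ, hψV, hψι, hψ⟩ := exists_hom_completion_quotient ι hι N
    -- the canonical map of `Q = P/N`, with codomain literally the completion
    let ηQ : (P ⧸ N.toSubgroup) →* completion (GrpCat.of (P ⧸ N.toSubgroup)) :=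
      (ProfiniteGrp.ProfiniteCompletion.eta (GrpCat.of (P ⧸ N.toSubgroup))).hom
    have hηQ : ∀ (q : P ⧸ N.toSubgroup) (M : FiniteIndexNormalSubgroup (P ⧸ N.toSubgroup)),
        (ηQ q).val M = (QuotientGroup.mk q : (P ⧸ N.toSubgroup) ⧸ M.toSubgroup) := fun _ _ => rfl
    -- `ψ ∘ ι = ηQ ∘ mk`
    have hψι' : ∀ p : P, ψ (ι p) = ηQ (QuotientGroup.mk' N.toSubgroup p) := by
      intro p
      apply ext_val
      intro M
      rw [hψι, hηQ, QuotientGroup.mk'_apply]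
    have hmaps : (H.map ι.toMonoidHom).map ψ = (H.map (QuotientGroup.mk' N.toSubgroup)).map ηQ := by
      rw [Subgroup.map_map, Subgroup.map_map]
      congr 1
      ext p
      exact hψι' p
    -- `ψ a` normalises `ηQ(H/N)`
    have h1 : ψ a ∈ Subgroup.normalizer
        (((H.map (QuotientGroup.mk' N.toSubgroup)).map ηQ : Subgroup _) : Set _) := by
      rw [← hmaps]
      exact Subgroup.le_normalizer_map ψ ⟨a, ha, rfl⟩
    -- Lemma 2.17 (i) at the level `P/N`
    have h2 : Subgroup.normalizer
        (((H.map (QuotientGroup.mk' N.toSubgroup)).map ηQ : Subgroup _) : Set _) =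
        (Subgroup.normalizer ((H.map (QuotientGroup.mk' N.toSubgroup) :
          Subgroup (P ⧸ N.toSubgroup)) : Set (P ⧸ N.toSubgroup))).map ηQ :=
      h217i (P ⧸ N.toSubgroup) G (H.map (QuotientGroup.mk' N.toSubgroup)) hGn hGfi hGfin hnc
    rw [h2] at h1
    obtain ⟨q, hq, hqa⟩ := h1
    obtain ⟨n, rfl⟩ := QuotientGroup.mk'_surjective N.toSubgroup q
    -- `n ∈ N_Π(H)` since `N ≤ H`
    have hn : n ∈ Subgroup.normalizer (H : Set P) := by
      rw [SetLike.mem_coe, Subgroup.mem_normalizer_iff] at hq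
      rw [Subgroup.mem_normalizer_iff]
      intro h
      constructor
      · intro hh
        obtain ⟨h', hh', he⟩ := (hq (QuotientGroup.mk' N.toSubgroup h)).mp ⟨h, hh, rfl⟩
        rw [← map_mul, ← map_inv, ← map_mul, QuotientGroup.mk'_apply, QuotientGroup.mk'_apply,
          QuotientGroup.eq] at he
        have : h'⁻¹ * (n * h * n⁻¹) ∈ H := hNH he
        simpa using H.mul_mem hh' this
      · intro hh
        obtain ⟨h', hh', he⟩ := (hq (QuotientGroup.mk' N.toSubgroup h)).mpr
          ⟨n * h * n⁻¹, hh, by rw [map_mul, map_mul, map_inv]⟩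
        rw [QuotientGroup.mk'_apply, QuotientGroup.mk'_apply, QuotientGroup.eq] at he
        have : h'⁻¹ * h ∈ H := hNH he
        simpa using H.mul_mem hh' this
    refine ⟨n, hn, fun M V hMV => (hψ a M n V hMV).mp ?_⟩
    rw [← hqa]
    exact hηQ _ M
  choose nf hnf_norm hnf using key
  -- STEP 2: coherence of the `n_N` along `N₁ ≤ N₂`
  have hcoh : ∀ (N₁ N₂ : OpenNormalSubgroup P) (h₁ : Good N₁) (h₂ : Good N₂),
      N₁.toSubgroup ≤ N₂.toSubgroup → (nf N₁ h₁)⁻¹ * nf N₂ h₂ ∈ N₂.toSubgroup := by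
    intro N₁ N₂ h₁ h₂ hle
    haveI := hrf N₂ h₂
    rw [← QuotientGroup.eq_one_iff]
    apply Group.eq_one_iff_forall_finiteIndexNormalSubroup
    intro M₂
    obtain ⟨ψ₂, hψV₂, -, -⟩ := exists_hom_completion_quotient ι hι N₂
    obtain ⟨V, hV⟩ := hψV₂ M₂
    have hN₁V : N₁.toSubgroup ≤ V.toSubgroup.comap ι.toMonoidHom := by
      rw [← hV]
      intro p hp
      change QuotientGroup.mk' N₂.toSubgroup p ∈ M₂.toSubgroup
      have : QuotientGroup.mk' N₂.toSubgroup p = 1 := by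
        rw [QuotientGroup.mk'_apply, QuotientGroup.eq_one_iff]
        exact hle hp
      rw [this]
      exact one_mem _
    obtain ⟨M₁, hM₁⟩ := exists_level ι hι N₁ V hN₁V
    have e1 : a⁻¹ * ι (nf N₁ h₁) ∈ V := hnf N₁ h₁ M₁ V hM₁
    have e2 : a⁻¹ * ι (nf N₂ h₂) ∈ V := hnf N₂ h₂ M₂ V hV
    have e3 : (nf N₁ h₁)⁻¹ * nf N₂ h₂ ∈ V.toSubgroup.comap ι.toMonoidHom := by
      change ι ((nf N₁ h₁)⁻¹ * nf N₂ h₂) ∈ V.toSubgroup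
      have := V.toSubgroup.mul_mem (V.toSubgroup.inv_mem e1) e2
      simpa [map_mul, map_inv, mul_assoc] using this
    rw [← hV] at e3
    exact e3
  -- STEP 3: the compatible family of cosets and its limit `n ∈ Π` (completeness of `Π`)
  have hchoice : ∀ M₀ : OpenNormalSubgroup P, ∃ N : OpenNormalSubgroup P,
      N.toSubgroup ≤ M₀.toSubgroup ∧ Good N := by
    intro M₀
    obtain ⟨N, hNU, hN⟩ := hgood (M₀ : Set P) M₀.toOpenSubgroup.mem_nhds_one
    exact ⟨N, fun p hp => hNU hp, hN⟩
  choose Nf hNf_le hNf_good using hchoice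
  obtain ⟨n, hn⟩ := hP.complete (fun M₀ => QuotientGroup.mk (nf (Nf M₀) (hNf_good M₀))) (by
    intro M₀ M₀' hle p hp
    have hp' : (nf (Nf M₀) (hNf_good M₀))⁻¹ * p ∈ M₀'.toSubgroup := hle (QuotientGroup.eq.mp hp)
    -- compare through a common good refinement of `Nf M₀` and `Nf M₀'`
    let W : OpenNormalSubgroup P :=
      { toOpenSubgroup := (Nf M₀).toOpenSubgroup ⊓ (Nf M₀').toOpenSubgroup
        isNormal' := Subgroup.normal_inf_normal (Nf M₀).toSubgroup (Nf M₀').toSubgroup }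
    obtain ⟨N'', hN''W, hN''⟩ := hgood (W : Set P) W.toOpenSubgroup.mem_nhds_one
    have hle₁ : N''.toSubgroup ≤ (Nf M₀).toSubgroup := fun p hp => (hN''W hp).1
    have hle₂ : N''.toSubgroup ≤ (Nf M₀').toSubgroup := fun p hp => (hN''W hp).2
    have c1 := hcoh N'' (Nf M₀) hN'' (hNf_good M₀) hle₁
    have c2 := hcoh N'' (Nf M₀') hN'' (hNf_good M₀') hle₂
    have : (nf (Nf M₀) (hNf_good M₀))⁻¹ * nf (Nf M₀') (hNf_good M₀') ∈ M₀'.toSubgroup := by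
      have h3 := M₀'.toSubgroup.mul_mem
        (M₀'.toSubgroup.inv_mem (hle (hNf_le M₀ c1))) (hNf_le M₀' c2)
      simpa [mul_assoc] using h3
    apply QuotientGroup.eq.mpr
    have h4 := M₀'.toSubgroup.mul_mem (M₀'.toSubgroup.inv_mem this) hp'
    simpa [mul_assoc] using h4)
  -- `n ≡ n_N (mod N)` for EVERY good `N`
  have hnN : ∀ (N : OpenNormalSubgroup P) (hN : Good N), (nf N hN)⁻¹ * n ∈ N.toSubgroup := by
    intro N hN
    have h1 : (nf (Nf N) (hNf_good N))⁻¹ * n ∈ N.toSubgroup := by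
      rw [← QuotientGroup.eq]
      exact hn N
    have h2 := hcoh (Nf N) N (hNf_good N) hN (hNf_le N)
    have := N.toSubgroup.mul_mem (N.toSubgroup.inv_mem h2) h1
    simpa [mul_assoc] using this
  -- STEP 4: `n ∈ N_Π(H)` and `ι n = a`
  obtain ⟨N₀, -, hN₀⟩ := hgood Set.univ Filter.univ_mem
  have hnorm : n ∈ Subgroup.normalizer (H : Set P) := by
    have h1 : (nf N₀ hN₀)⁻¹ * n ∈ Subgroup.normalizer (H : Set P) :=
      Subgroup.le_normalizer (hN₀.1 (hnN N₀ hN₀))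
    have := (Subgroup.normalizer (H : Set P)).mul_mem (hnf_norm N₀ hN₀) h1
    simpa using this
  refine ⟨n, hnorm, ?_⟩
  have hfinal : a⁻¹ * ι n = 1 := by
    apply eq_one_of_forall_mem_openNormalSubgroup
    intro V
    let M₀ : OpenNormalSubgroup P :=
      { toOpenSubgroup := ⟨V.toSubgroup.comap ι.toMonoidHom, hι.isOpen_comap V⟩
        isNormal' := Subgroup.Normal.comap inferInstance _ }
    obtain ⟨N, hNU, hN⟩ := hgood (M₀ : Set P) M₀.toOpenSubgroup.mem_nhds_one
    have hNV : N.toSubgroup ≤ V.toSubgroup.comap ι.toMonoidHom := fun p hp => hNU hp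
    obtain ⟨M, hM⟩ := exists_level ι hι N V hNV
    have e1 : a⁻¹ * ι (nf N hN) ∈ V := hnf N hN M V hM
    have e2 : ι ((nf N hN)⁻¹ * n) ∈ V.toSubgroup := hNV (hnN N hN)
    have e3 : a⁻¹ * ι n = (a⁻¹ * ι (nf N hN)) * ι ((nf N hN)⁻¹ * n) := by
      rw [map_mul, map_inv]
      group
    rw [e3]
    exact V.toSubgroup.mul_mem e1 e2
  change ι n = a
  exact (inv_mul_eq_one.mp hfinal).symm

end Literature.AnabelianGeometry.EtaleTheta.DiscreteNormalizers
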